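import Summits.CriticalPhenomena.SAWScalingLimit.Theorems.SAWDevelopingMapObservableToSLEChordalCarrierReduction
import Summits.CriticalPhenomena.SAWScalingLimit.Theorems.SAWDevelopingMapObservableToSLEChordalCarrierCollars

/-!
# Crux `SAWDevelopingMap.ObservableToSLE` (stmt-CriticalPhenomena-10472), line
`floor-ratio-restriction-bootstrap`, registered stub `stub_chordalCarrier`: the stub modulo ONE
lattice estimate

Landing target:
`Summits/CriticalPhenomena/SAWScalingLimit/Theorems/SAWDevelopingMapObservableToSLEChordalCarrier.lean`
(`--supports stmt-CriticalPhenomena-10472`).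

The registered stub `stub_chordalCarrier` says: the canonical restriction limits on floor domains
(`FloorRestrictionLimit`: for floor domains `D`, hull subdomains `D'`, chordal `φ`, restriction data
`(Φ, d)` and floor-vertex endpoints, `P_δ(the critical hexagonal SAW is a D'-mesh walk) → d^{5/8}`)
imply that every probability subsequential limit law of the critical hexagonal SAW curves in a
floor domain with floor-vertex endpoints is carried by `chordalCarrier D` (SIMPLE classes from `a`
to `b` with trace in `D ∪ {a, b}`).  Four of the five clauses are PROVED from the hypothesis in the
sibling files (`…ChordalCarrierLimits`: endpoints and confinement; `…ChordalCarrierReduction` +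
`…ChordalCarrierCollars`: boundary avoidance off `a, b`, through thin half-ellipse hull subdomains
with `Φ'_A(0) → 1` and the closed-set portmanteau transfer).  The fifth clause, SIMPLICITY, is not
a consequence of weak convergence and lattice self-avoidance (`CurveClass.simple` is not closed:
`SimpleSubseqLimits.Negative.simple_not_isClosed`) and no estimate in print supplies it at `x_c`;
this file proves the stub MODULO exactly one lattice estimate, the **uniform injectivity modulus**
of the critical hexagonal SAW on floor domains (`stub_chordalCarrier_ofModulus`): for every
`ε, η > 0` there is `θ > 0` such that for all small meshes, with probability `≥ 1 - η`, no two
`θ`-close points of the rescaled walk are separated along the walk by a point at distance `> ε`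
from the first (`CurveClass.modulusClass ε θ`; no macroscopic near-retracing / no `ε`-fjord of
width `θ`, uniformly in `δ`).  Expected (not available) tool: strip subcriticality of `x_c`-bridges
and unfolding surgery (`exp(-c L/w)` for two parallel strands of length `L` at width `w`); it is
implied by DCS Conjecture 1 and is the `NoRetrace` stub of the sibling line
`coalescent-arc-restriction` in mesh-free form.
-/

noncomputable section

open scoped BigOperators Topology NNReal ENNReal Classical
open Filter Set MeasureTheory Metric
open Literature.Probability.LatticeModels (HexVertex hexGraph hexCenter)
open Literature.Probability.RandomPlanarGeometry
open Literature.Probability.RandomPlanarGeometry.SAW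
open UpperHalfPlane (upperHalfPlaneSet)

namespace Summit.CriticalPhenomena.SAWScalingLimit.Theorems.ObservableToSLE.FloorRatio

/-- **`stub_chordalCarrier` modulo the uniform injectivity modulus** (crux item
stmt-CriticalPhenomena-10472, line `floor-ratio-restriction-bootstrap`).  The FIRST hypothesis is
the isolated missing estimate — the uniform injectivity modulus of the critical hexagonal SAW on
floor domains with floor-vertex endpoints; the REST is the registered signature of
`stub_chordalCarrier` verbatim (hypothesis `FloorRestrictionLimit` unfolded, then the conclusion
`∀ᵐ c ∂μ, c ∈ chordalCarrier D` for floor domains, floor endpoint approximations and probability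
subsequential limit laws).  Proof: `stub_chordalCarrier_reduction` with the collar families of
`stub_chordalCarrier_collars` fed by the restriction limits of THIS floor domain.
[cite: LawlerSchrammWerner2003Restriction, Lemma 3.2 and Thm. 6.1 (transposed)] -/
theorem stub_chordalCarrier_ofModulus :
    (∀ (D : DobrushinDomain) (ρ : ℝ) (a b : ℝ → HexVertex),
      (0 < ρ ∧ (D.pt 1).im = (D.pt 0).im ∧ D.carrier ⊆ {z : ℂ | (D.pt 0).im < z.im} ∧
      D.carrier ∩ ball (D.pt 0) ρ = {z : ℂ | (D.pt 0).im < z.im} ∩ ball (D.pt 0) ρ ∧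
      D.carrier ∩ ball (D.pt 1) ρ = {z : ℂ | (D.pt 1).im < z.im} ∩ ball (D.pt 1) ρ) →
      (IsEmbEndpointApprox hexGraph hexCenter D a b ∧ ∀ᶠ δ : ℝ in 𝓝[>] 0,
      (∃ u : HexVertex, hexGraph.Adj (a δ) u ∧ ((δ : ℂ) * hexCenter u).im ≤ (D.pt 0).im) ∧
      (∃ u : HexVertex, hexGraph.Adj (b δ) u ∧ ((δ : ℂ) * hexCenter u).im ≤ (D.pt 1).im)) →
      ∀ ε η : ℝ, 0 < ε → 0 < η → ∃ θ : ℝ, 0 < θ ∧ ∀ᶠ δ : ℝ in 𝓝[>] 0,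
        hexSAWLaw D.carrier δ (a δ) (b δ) {γ | γ.curve ∉ CurveClass.modulusClass ε θ} ≤
          ENNReal.ofReal η) →
    (
    ∀ (D D' : DobrushinDomain) (ρ : ℝ) (φ : ConformalEquiv upperHalfPlaneSet D.carrier)
    (Φ : ConformalEquiv (upperHalfPlaneSet \ φ.pullbackHull D') upperHalfPlaneSet) (d : ℝ)
    (a b : ℝ → HexVertex),
    (0 < ρ ∧ (D.pt 1).im = (D.pt 0).im ∧ D.carrier ⊆ {z : ℂ | (D.pt 0).im < z.im} ∧
    D.carrier ∩ ball (D.pt 0) ρ = {z : ℂ | (D.pt 0).im < z.im} ∩ ball (D.pt 0) ρ ∧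
    D.carrier ∩ ball (D.pt 1) ρ = {z : ℂ | (D.pt 1).im < z.im} ∩ ball (D.pt 1) ρ) → D.IsHullSubdomain D' → D.IsChordalUniformizing φ →
    IsRestrictionMap (φ.pullbackHull D') Φ → HasRestrictionDeriv (φ.pullbackHull D') Φ d →
    (IsEmbEndpointApprox hexGraph hexCenter D a b ∧ ∀ᶠ δ : ℝ in 𝓝[>] 0,
    (∃ u : HexVertex, hexGraph.Adj (a δ) u ∧ ((δ : ℂ) * hexCenter u).im ≤ (D.pt 0).im) ∧
    (∃ u : HexVertex, hexGraph.Adj (b δ) u ∧ ((δ : ℂ) * hexCenter u).im ≤ (D.pt 1).im)) →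
    Tendsto (fun δ : ℝ => ((hexSAWLaw D.carrier δ (a δ) (b δ))
    {γ | (∀ v ∈ γ.walk.support, v ∈ embMeshVertices hexCenter D'.carrier δ) ∧
    ∀ e ∈ γ.walk.darts,
    (embMeshGraph hexGraph hexCenter D'.carrier δ).Adj e.fst e.snd}).toReal)
    (𝓝[>] 0) (𝓝 (d ^ ((5 : ℝ) / 8)))) →
    ∀ (D : DobrushinDomain) (ρ : ℝ) (a b : ℝ → HexVertex),
      (0 < ρ ∧ (D.pt 1).im = (D.pt 0).im ∧ D.carrier ⊆ {z : ℂ | (D.pt 0).im < z.im} ∧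
      D.carrier ∩ ball (D.pt 0) ρ = {z : ℂ | (D.pt 0).im < z.im} ∩ ball (D.pt 0) ρ ∧
      D.carrier ∩ ball (D.pt 1) ρ = {z : ℂ | (D.pt 1).im < z.im} ∩ ball (D.pt 1) ρ) → (IsEmbEndpointApprox hexGraph hexCenter D a b ∧ ∀ᶠ δ : ℝ in 𝓝[>] 0,
      (∃ u : HexVertex, hexGraph.Adj (a δ) u ∧ ((δ : ℂ) * hexCenter u).im ≤ (D.pt 0).im) ∧
      (∃ u : HexVertex, hexGraph.Adj (b δ) u ∧ ((δ : ℂ) * hexCenter u).im ≤ (D.pt 1).im)) →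
      ∀ μ : Measure (CurveClass ℂ), IsProbabilityMeasure μ →
        IsSubseqLimitLaw (fun δ (γ : HexDomainSAW D.carrier δ (a δ) (b δ)) => γ.curve)
          (fun δ => hexSAWLaw D.carrier δ (a δ) (b δ)) μ →
        ∀ᵐ c ∂μ, c ∈ chordalCarrier D := by
  intro hUIM hFRL D ρ a b hD hab μ hμP hμ
  exact stub_chordalCarrier_reduction D a b hab.1 (hUIM D ρ a b hD hab)
    (stub_chordalCarrier_collars D a b fun D' φ Φ d hD' hφ hΦ hd ↦
      hFRL D D' ρ φ Φ d a b hD hD' hφ hΦ hd hab) μ hμP hμ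

end Summit.CriticalPhenomena.SAWScalingLimit.Theorems.ObservableToSLE.FloorRatio

end
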